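import Summits.MatrixMultiplication.MatrixMultiplication.Theorems.AbelianSTPPCensusTCStatRows

/-!
# T_C static certificate, orders `628 … 2880`: soundness (the main estimate; theory's range-C file verbatim at universe `2880`, `τ = 12/5`)

Cell mm-stpp (rung F-M1), tier T_C = «beat `2.4`»; checker in `AbelianSTPPCensusTCStatDefs.lean`, data facts in `AbelianSTPPCensusTCStatRows.lean`, arithmetic
toolbox `AbelianSTPPCensusTAStatLemmas.lean` (theory g11, `τ`-free, reused by name).  Theory g12's `AbelianSTPPCensusTAStatCSound.lean` VERBATIM with
`5667/6190/337 → 628/2880/202`, `gainOf2371i → gainOfTC`, exponent `2371/1000 → 12/5` — companion of `AbelianSTPPCensusTDStatSound.lean` (same session).  Proofs only: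
`sum_gain_le` (`Σ_i gainOfTC(V_i) ≤ 10⁶·M` for every `SieveAdmissible ∧ U11G ∧ E3Adm` shape list with `≥ 2` members at `628 ≤ M ≤ 2880`, given `monoOK`, `domV`,
`checkV`) and `not_beats_of_cert` (`¬ Beats (12/5) M`, via `ShapeCert.rpow_le_gainTC`).
WHAT THIS IS NOT: arithmetic about shape lists only; no statement about STPP families or `ω`; nothing outside `628 … 2880`.
-/

set_option linter.dupNamespace false
set_option autoImplicit false

namespace Summit.MatrixMultiplication.MatrixMultiplication.Theorems.TCStat

open TECert (tableOK vol us tableOK_iff tableOK_mono)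
open ShapeCert (gainOfTC D)
open TCStatData (E VL TB nl nb)
open TAStat (tm Entry e0 domP leP leW vpI p1I p2I p3I piece pcs vpCand vpThresh cover tm_sorted getD_drop_add pcs_sound
  grynkiewicz_budget'_A grynkiewicz_budget'_B grynkiewicz_budget'_C tm_eq_of_cases affine_between quad_between vp_mono p1_between p2_between
  vpThresh_le capE_mul_le)

/-! ## The main estimate -/

set_option maxHeartbeats 4000000 in
/-- **Arithmetic core of the static t*-certificate.**  Table facts, domination of every sorted candidate and all checks passing on the volumes
`1 … 2880` imply: every shape list that is `SieveAdmissible M`, `U11G M` and `E3Adm M`, with at least two members, at an order `628 ≤ M ≤ 2880`,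
has `Σ_i gainOfTC (a_i b_i c_i) ≤ 10⁶ · M`. [original] -/
theorem sum_gain_le (hmono : monoOK nl nb = true)
    (hdom : ∀ V, 1 ≤ V → V ≤ 2880 → ∀ x ∈ triplesS V, domX V (gainOfTC V) x = true)
    (hck : ∀ V, 1 ≤ V → V ≤ 2880 → ∀ x ∈ triplesS V, checkShape V (gainOfTC V) x = true)
    {N M : ℕ} {a b c : Fin N → ℕ} (hN : 2 ≤ N) (hlo : 628 ≤ M) (hM : M ≤ 2880)
    (hS : SieveAdmissible M a b c) (hG : U11G M a b c) (hE : TAKnap575.E3Adm M a b c) :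
    ∑ i, gainOfTC (a i * b i * c i) ≤ D * M := by
  classical
  have hS' := hS
  obtain ⟨h1, h2, -, h4, h5, h6, -⟩ := hS
  haveI : Nontrivial (Fin N) := Fin.nontrivial_iff_two_le.mpr hN
  -- every member: sizes ≥ 1 and the table at `Mtop = 2880`
  have hcand : ∀ i, 1 ≤ a i ∧ 1 ≤ b i ∧ 1 ≤ c i ∧ tableOK Mtop (a i) (b i) (c i) = true := by
    intro i
    obtain ⟨ha, hb, hc, hV⟩ := h1 i
    obtain ⟨n1, n2, n3⟩ := h2 i
    obtain ⟨j, hj⟩ := exists_ne i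
    obtain ⟨u1, u2, u3, -⟩ := h5 i j hj.symm
    refine ⟨ha, hb, hc, tableOK_mono ((tableOK_iff _ _ _ _).mpr ⟨?_, n1, n2, n3, ?_, ?_, ?_⟩) hM⟩ <;>
      simp only [shapeVol] at hV u1 u2 u3 ⊢ <;> omega
  -- sorted forms
  have hsort : ∀ i, ∃ y : ℕ × ℕ × ℕ, SCand y ∧ vol y = a i * b i * c i ∧ us y = a i * b i + b i * c i + c i * a i ∧
      y.1 + y.2.1 + y.2.2 = a i + b i + c i ∧ tm (a i, b i, c i) = y.1 * y.2.1 ∧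
      ((y.1 = a i ∧ y.2.1 = min (c i) (b i) ∧ a i ≤ c i ∧ a i ≤ b i) ∨ (y.1 = b i ∧ y.2.1 = min (a i) (c i) ∧ b i ≤ a i ∧ b i ≤ c i) ∨
        (y.1 = c i ∧ y.2.1 = min (b i) (a i) ∧ c i ≤ b i ∧ c i ≤ a i)) := by
    intro i
    obtain ⟨ha, hb, hc, ht⟩ := hcand i
    obtain ⟨y, hy, hv, hu, hs, hcs⟩ := exists_sorted (a i) (b i) (c i) ha hb hc ht
    exact ⟨y, hy, hv, hu, hs, tm_eq_of_cases hcs, hcs⟩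
  -- the member of maximal volume
  obtain ⟨l, -, hl⟩ := Finset.exists_max_image Finset.univ (fun i => a i * b i * c i) ⟨⟨0, by omega⟩, Finset.mem_univ _⟩
  set Vl := a l * b l * c l with hVl
  have hVlM : Vl + 1 ≤ M := by
    obtain ⟨j, hj⟩ := exists_ne l
    have := (h5 l j hj.symm).1; simp only [shapeVol] at this; have := (h1 l).1; omega
  have hVl5 : Vl ≤ 2880 := by omega
  have hVl1 : 1 ≤ Vl := Nat.mul_pos (Nat.mul_pos (h1 l).1 (h1 l).2.1) (h1 l).2.2.1
  -- the member of maximal `t`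
  obtain ⟨m, -, hm⟩ := Finset.exists_max_image Finset.univ (fun i => tm (a i, b i, c i)) ⟨⟨0, by omega⟩, Finset.mem_univ _⟩
  set ts := tm (a m, b m, c m) with hts
  obtain ⟨ym, hym, hvm, hum, hsm, htmm, hcsm⟩ := hsort m
  -- bounds on ts: 1 ≤ ts, ts³ ≤ V_m² ≤ Vl²  ⇒ ts ≤ 202
  have hts1 : 1 ≤ ts := by
    rw [hts, htmm]; exact Nat.mul_pos hym.1 (le_trans hym.1 hym.2.1)
  have hts3 : ts * ts * ts ≤ Vl * Vl := by
    have hy3 : ym.1 * ym.2.1 ≤ ym.2.2 * ym.2.2 := Nat.mul_le_mul (le_trans hym.2.1 hym.2.2.1) hym.2.2.1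
    have hvm' : a m * b m * c m ≤ Vl := hl m (Finset.mem_univ m)
    rw [hts, htmm]
    calc ym.1 * ym.2.1 * (ym.1 * ym.2.1) * (ym.1 * ym.2.1) ≤ ym.1 * ym.2.1 * (ym.1 * ym.2.1) * (ym.2.2 * ym.2.2) :=
          Nat.mul_le_mul_left _ hy3
      _ = vol ym * vol ym := by simp only [vol]; ring
      _ ≤ Vl * Vl := by rw [hvm]; exact Nat.mul_le_mul hvm' hvm'
  have hts292 : ts ≤ 202 := by
    apply sentinel
    calc ts ^ 3 = ts * ts * ts := by ring
      _ ≤ Vl * Vl := hts3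
      _ ≤ 2880 * 2880 := Nat.mul_le_mul hVl5 hVl5
      _ = 2880 ^ 2 := by norm_num
  -- the bucket of ts and the budget parameter t' = tp j ≤ tb j
  set j := bucketOf ts with hj
  obtain ⟨hjnb, htbj, htbj1⟩ := bucketOf_spec ts (by omega) hts1
  obtain ⟨htp19, htptb⟩ := tp_facts hmono j hjnb
  set t := tp j with ht
  -- sorted form of l, its check
  obtain ⟨y, hy, hyv, hyu, hys, hytm, -⟩ := hsort l
  have hmem : y ∈ triplesS Vl := by
    have := mem_triplesS (a := y.1) (b := y.2.1) (c := y.2.2) hy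
    have e : y.1 * y.2.1 * y.2.2 = Vl := hyv
    rw [e] at this; exact this
  have hchk := hck Vl hVl1 hVl5 y hmem
  -- unpack checkShape: the range test fails, so the walk passed
  have hL : max lo (Vl + 1) ≤ M := by simp only [lo]; omega
  simp only [checkShape, Bool.or_eq_true, Nat.blt_eq] at hchk
  rcases hchk with hbad | hwalk
  · exfalso; simp only [Mtop] at hbad; omega
  -- the walk reaches bucket j
  set j0 := bucketOf (y.1 * y.2.1) with hj0
  have htl_ts : y.1 * y.2.1 ≤ ts := by rw [← hytm]; exact hm l (Finset.mem_univ l)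
  have htl1 : 1 ≤ y.1 * y.2.1 := Nat.mul_pos hy.1 (le_trans hy.1 hy.2.1)
  have hj0j : j0 ≤ j := bucketOf_mono htl_ts (by omega)
  set i₀ := levOf Vl with hi₀
  have hi₀nl : i₀ < nl := (levOf_spec Vl hVl5).1
  have hlen : (E.getD i₀ []).length = nb := row_length i₀ hi₀nl
  have hk : j - j0 < ((E.getD i₀ []).drop j0).length := by rw [List.length_drop, hlen]; omega
  have hcov := walk_sound _ _ _ _ _ _ _ _ hwalk (j - j0) hk (fun k' hk' => by
    have h1 : tb (j0 + k') ≤ tb j := tb_mono (by omega) (by omega)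
    have h2 : tb j ≤ ts := htbj
    calc tb (j0 + k') * tb (j0 + k') * tb (j0 + k') ≤ ts * ts * ts :=
          Nat.mul_le_mul (Nat.mul_le_mul (h1.trans h2) (h1.trans h2)) (h1.trans h2)
      _ ≤ Vl * Vl := hts3)
  rw [getD_drop_add, show j0 + (j - j0) = j by omega] at hcov
  -- name the entry and the quantities of l
  set e := ent i₀ j with he
  have hent : (E.getD i₀ []).getD j e0 = e := rfl
  rw [hent] at hcov
  set g := gainOfTC Vl with hg
  -- domination of every member at (i₀, j), read at t
  have hdomi : ∀ i, 1 ≤ e.2.1 ∧ 1 ≤ e.2.2.2 ∧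
      gainOfTC (a i * b i * c i) * e.2.1 ≤ e.1 * (a i * b i + b i * c i + c i * a i) ∧
      a i * b i * c i < t * (a i * b i + b i * c i + c i * a i) ∧
      gainOfTC (a i * b i * c i) * e.2.2.2 ≤ e.2.2.1 * (t * (a i * b i + b i * c i + c i * a i) - a i * b i * c i) := by
    intro i
    obtain ⟨yi, hyi, hvi, hui, -, htmi, -⟩ := hsort i
    have hvle : vol yi ≤ Vl := by rw [hvi]; exact hl i (Finset.mem_univ i)
    have htmle : tm yi ≤ ts := by
      rw [tm_sorted hyi.2.1 hyi.2.2.1, ← htmi]; exact hm i (Finset.mem_univ i)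
    have := dominated hmono hdom hyi hVl5 hvle hts1 hts292 htmle
    rw [hvi, hui] at this
    exact this
  obtain ⟨hp1, hw1, -, -, -⟩ := hdomi l
  -- common facts: split off the maximal member
  have esplit : ∀ f : Fin N → ℕ, ∑ q, f q = f l + ∑ q ∈ Finset.univ.erase l, f q :=
    fun f => (Finset.add_sum_erase _ _ (Finset.mem_univ l)).symm
  set p : Fin N → ℕ := fun q => a q * b q + b q * c q + c q * a q with hp
  have hpll : p l = us y := by rw [hyu]
  -- unpack cover
  simp only [cover, Bool.or_eq_true, Nat.ble_eq] at hcov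
  set M1 := vpThresh g (us y) Vl t (max lo (Vl + 1)) Mtop e with hM1
  by_cases hVP : M1 ≤ M
  · ---------------------------------------------------------------- case U11-G
    have hM1H : M1 ≤ Mtop := hVP.trans hM
    obtain ⟨ht3, hVtp, hslope, hvp1, hwl1⟩ := vpThresh_le hM1H
    have hvp : vpI g (us y) Vl t M e = true := vp_mono hslope hVP hvp1
    have hwl : t * us y - Vl ≤ t * M := hwl1.trans (Nat.mul_le_mul_left _ hVP)
    simp only [vpI, Nat.ble_eq] at hvp
    -- the budget at t from member m
    have hsmall : ym.1 < t := by
      rcases htp19 with heq | h19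
      · -- t = tb j: ym.1² ≤ ts < tb (j+1) ≤ t²
        by_contra hge; push Not at hge
        have ht3' : 3 ≤ tb j := by rw [← heq]; exact ht3
        have hsq : tb (j + 1) ≤ t * t := by rw [heq]; exact tb_sq j hjnb ht3'
        have hsq2 : t * t ≤ ym.1 * ym.2.1 := Nat.mul_le_mul hge (le_trans hge hym.2.1)
        rw [← htmm] at hsq2
        exact absurd (lt_of_le_of_lt hsq2 htbj1) (not_lt.2 hsq)
      · -- 19 ≤ t: ym.1³ ≤ vol ym ≤ Vl < 19³
        have hvm' : a m * b m * c m ≤ Vl := hl m (Finset.mem_univ m)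
        have hcube : ym.1 * ym.1 * ym.1 ≤ Vl := by
          calc ym.1 * ym.1 * ym.1 ≤ ym.1 * ym.2.1 * ym.2.2 :=
                Nat.mul_le_mul (Nat.mul_le_mul_left _ hym.2.1) (le_trans hym.2.1 hym.2.2.1)
            _ = vol ym := by simp only [vol]
            _ ≤ Vl := by rw [hvm]; exact hvm'
        have h18 : ym.1 ≤ 18 := by
          by_contra hc; push Not at hc
          have : 19 * 19 * 19 ≤ ym.1 * ym.1 * ym.1 := Nat.mul_le_mul (Nat.mul_le_mul hc hc) hc
          omega
        omega
    have htle : t ≤ ym.1 * ym.2.1 := by rw [← htmm]; exact htptb.trans htbj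
    have hbud : t * (∑ i, p i) + 1 ≤ (∑ i, a i * b i * c i) + t * M + 2 * t ^ 2 := by
      rcases hcsm with ⟨hy1, hy2, -, -⟩ | ⟨hy1, hy2, -, -⟩ | ⟨hy1, hy2, -, -⟩
      · exact grynkiewicz_budget'_A hS' hG m (by rw [← hy1]; exact hsmall) (by rw [← hy1, ← hy2]; exact htle) ht3
      · exact grynkiewicz_budget'_B hS' hG m (by rw [← hy1]; exact hsmall) (by rw [← hy1, ← hy2]; exact htle) ht3
      · exact grynkiewicz_budget'_C hS' hG m (by rw [← hy1]; exact hsmall) (by rw [← hy1, ← hy2]; exact htle) ht3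
    -- weights positive, gains dominated
    have hwj : ∀ q, a q * b q * c q < t * p q ∧ gainOfTC (a q * b q * c q) * e.2.2.2 ≤ e.2.2.1 * (t * p q - a q * b q * c q) := by
      intro q; obtain ⟨-, -, -, hlt, hW⟩ := hdomi q; exact ⟨hlt, hW⟩
    have hcore : (∑ q ∈ Finset.univ.erase l, (t * p q - a q * b q * c q)) + (t * us y - Vl) ≤ t * M + (2 * t * t - 1) := by
      have eW : (∑ q ∈ Finset.univ.erase l, (t * p q - a q * b q * c q)) + ∑ q ∈ Finset.univ.erase l, a q * b q * c q =
          ∑ q ∈ Finset.univ.erase l, t * p q := by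
        rw [← Finset.sum_add_distrib]
        exact Finset.sum_congr rfl fun q _ => Nat.sub_add_cancel (hwj q).1.le
      have eT : ∑ q ∈ Finset.univ.erase l, t * p q = t * ∑ q ∈ Finset.univ.erase l, p q := (Finset.mul_sum _ _ _).symm
      have s1 := esplit p
      have s2 := esplit (fun q => a q * b q * c q)
      rw [← hVl] at s2
      have hl1 := (hwj l).1
      rw [hpll, ← hVl] at hl1
      generalize hA : ∑ q ∈ Finset.univ.erase l, (t * p q - a q * b q * c q) = A at *
      generalize hB : ∑ q ∈ Finset.univ.erase l, a q * b q * c q = B at *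
      generalize hC : ∑ q ∈ Finset.univ.erase l, p q = C at *
      generalize hTM : t * M = TM at *
      generalize hTp : t * us y = Tp at *
      generalize hTC : t * C = TC at *
      have e3 : t * (p l + C) = Tp + TC := by rw [← hTp, ← hTC, hpll]; ring
      have e4 : 2 * t ^ 2 = 2 * t * t := by ring
      rw [s1, s2, e3, e4] at hbud
      omega
    have hsumw : e.2.2.1 * (∑ q ∈ Finset.univ.erase l, (t * p q - a q * b q * c q)) + e.2.2.1 * (t * us y - Vl) ≤
        e.2.2.1 * (t * M) + e.2.2.1 * (2 * t * t - 1) := by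
      rw [← Nat.mul_add, ← Nat.mul_add]; exact Nat.mul_le_mul_left _ hcore
    have hsumg : (∑ q ∈ Finset.univ.erase l, gainOfTC (a q * b q * c q)) * e.2.2.2 ≤
        e.2.2.1 * ∑ q ∈ Finset.univ.erase l, (t * p q - a q * b q * c q) := by
      rw [Finset.sum_mul, Finset.mul_sum]
      exact Finset.sum_le_sum fun q _ => (hwj q).2
    rw [esplit (fun q => gainOfTC (a q * b q * c q)), ← hVl]
    have hvp' : t * e.2.2.1 * M + (gainOfTC Vl * e.2.2.2 + (2 * t * t - 1) * e.2.2.1) ≤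
        D * e.2.2.2 * M + (t * us y - Vl) * e.2.2.1 := by simpa only [hg] using hvp
    have key : (gainOfTC Vl + ∑ q ∈ Finset.univ.erase l, gainOfTC (a q * b q * c q)) * e.2.2.2 ≤ D * M * e.2.2.2 := by
      rw [Nat.add_mul]
      linarith only [hsumg, hsumw, hvp']
    exact Nat.le_of_mul_le_mul_right key hw1
  · ---------------------------------------------------------------- case vM
    push Not at hVP
    have hMhi : M ≤ min Mtop (M1 - 1) := by simp only [Mtop]; omega
    rcases hcov with hle | hpc
    · exfalso; omega
    -- a piece containing M
    obtain ⟨m₁, m₂, hm0, hm1, hm2, hpiece⟩ : ∃ m₁ m₂, max lo (Vl + 1) ≤ m₁ ∧ m₁ ≤ M ∧ M ≤ m₂ ∧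
        piece g Vl (2 * us y - (y.1 + y.2.1 + y.2.2)) e m₁ m₂ = true := by
      rcases hpc with hp | hp
      · exact ⟨_, _, le_rfl, hL, hMhi, hp⟩
      · exact pcs_sound g Vl _ e J _ _ hp M hL hMhi
    have hm1' : 1 ≤ m₁ := le_trans (by simp [lo]) hm0
    -- the others' pair-product sums and gains
    have hsumg : (∑ q ∈ Finset.univ.erase l, gainOfTC (a q * b q * c q)) * e.2.1 ≤ e.1 * ∑ q ∈ Finset.univ.erase l, p q := by
      rw [Finset.sum_mul, Finset.mul_sum]
      exact Finset.sum_le_sum fun q _ => (hdomi q).2.2.1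
    -- U11 rows at l: 2 Σ_o p + d ≤ 3M
    obtain ⟨hA, hB, hC⟩ := h4 l
    have e2 : (∑ q, a q * (b q + c q)) + (∑ q, b q * (c q + a q)) + ∑ q, c q * (a q + b q) = 2 * ∑ q, p q := by
      rw [Finset.mul_sum, ← Finset.sum_add_distrib, ← Finset.sum_add_distrib]
      exact Finset.sum_congr rfl fun q _ => by simp only [hp]; ring
    have hdd : y.1 + y.2.1 + y.2.2 ≤ 2 * us y := by
      obtain ⟨y1, y12, y23, -⟩ := hy
      simp only [us, TECert.uu, TECert.vv, TECert.ww]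
      have e1 : y.1 ≤ y.1 * y.2.1 := Nat.le_mul_of_pos_right _ (by omega)
      have e2 : y.2.1 ≤ y.2.1 * y.2.2 := Nat.le_mul_of_pos_right _ (by omega)
      have e3 : y.2.2 ≤ y.2.2 * y.1 := Nat.le_mul_of_pos_right _ (by omega)
      omega
    have hsum1 : 2 * (∑ q ∈ Finset.univ.erase l, p q) + (2 * us y - (y.1 + y.2.1 + y.2.2)) ≤ 3 * M := by
      have s1 := esplit p
      rw [← hpll, hys]; rw [← hpll, hys] at hdd
      omega
    -- U14 rows at l: Σ_o p + 3Vl ≤ 3M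
    obtain ⟨hab, -, hbc, -, hca, -⟩ := h6 l
    simp only [u14Sum, shapeVol] at hab hbc hca
    have hsplit3 : ∑ q ∈ Finset.univ.erase l, p q = (∑ q ∈ Finset.univ.erase l, a q * b q) +
        (∑ q ∈ Finset.univ.erase l, b q * c q) + ∑ q ∈ Finset.univ.erase l, c q * a q := by
      rw [← Finset.sum_add_distrib, ← Finset.sum_add_distrib]
    have hsum2 : (∑ q ∈ Finset.univ.erase l, p q) + 3 * Vl ≤ 3 * M := by rw [hsplit3]; omega
    rw [esplit (fun q => gainOfTC (a q * b q * c q)), ← hVl, ← hg]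
    simp only [piece, Bool.or_eq_true, Bool.and_eq_true, Nat.blt_eq] at hpiece
    rcases hpiece with (⟨hP1a, hP1b⟩ | ⟨hP2a, hP2b⟩) | ⟨⟨h2V, hP3a⟩, hP3b⟩
    · -- U11 cap
      have hP := p1_between hm1 hm2 hP1a hP1b
      simp only [p1I, Nat.ble_eq] at hP
      have key : (g + ∑ q ∈ Finset.univ.erase l, gainOfTC (a q * b q * c q)) * (2 * e.2.1) ≤ D * M * (2 * e.2.1) := by
        have hs1 := Nat.mul_le_mul_left e.1 hsum1
        rw [Nat.add_mul]
        generalize (∑ q ∈ Finset.univ.erase l, gainOfTC (a q * b q * c q)) = S at hsumg ⊢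
        generalize (∑ q ∈ Finset.univ.erase l, p q) = So at hsumg hs1
        generalize (2 * us y - (y.1 + y.2.1 + y.2.2)) = dd at hs1 hP
        generalize e.1 = gP at hsumg hs1 hP
        generalize e.2.1 = pP at hsumg hP ⊢
        have e1 : gP * (2 * So + dd) = 2 * (gP * So) + gP * dd := by ring
        rw [e1] at hs1
        generalize g = gg at hP ⊢
        generalize D = DD at hP ⊢
        ring_nf at hsumg hs1 hP ⊢
        omega
      exact Nat.le_of_mul_le_mul_right key (by omega)
    · -- U14 cap
      have hP := p2_between hm1 hm2 hP2a hP2b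
      simp only [p2I, Nat.ble_eq] at hP
      have key : (g + ∑ q ∈ Finset.univ.erase l, gainOfTC (a q * b q * c q)) * e.2.1 ≤ D * M * e.2.1 := by
        have hs2 := Nat.mul_le_mul_left e.1 hsum2
        rw [Nat.add_mul]
        generalize (∑ q ∈ Finset.univ.erase l, gainOfTC (a q * b q * c q)) = S at hsumg ⊢
        generalize (∑ q ∈ Finset.univ.erase l, p q) = So at hsumg hs2
        generalize e.1 = gP at hsumg hs2 hP
        generalize e.2.1 = pP at hsumg hP ⊢
        have e1 : gP * (So + 3 * Vl) = gP * So + 3 * Vl * gP := by ring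
        rw [e1] at hs2
        generalize g = gg at hP ⊢
        generalize D = DD at hP ⊢
        ring_nf at hsumg hs2 hP ⊢
        omega
      exact Nat.le_of_mul_le_mul_right key hp1
    · -- E3 cap (M < 2 Vl)
      have h2V' : M < 2 * Vl := by omega
      have hE3 := hE l h2V'
      rw [← hVl] at hE3
      have he3 := TAKnap575.sum_us_le_of_e3 (by omega) (by omega) (by omega) h2V' hE3
      -- Σ_o p ≤ capE
      have hcap : ∑ q ∈ Finset.univ.erase l, p q ≤ (Vl * Vl / M + 3 * M) - 4 * Vl := by
        rw [hsplit3]; omega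
      have hM1' : 1 ≤ M := by omega
      have hP := quad_between hm1' hm1 hm2 hP3a hP3b
      simp only [p3I, Nat.ble_eq] at hP
      have hce := capE_mul_le (V := Vl) (M := M) (by omega)
      have key : (g + ∑ q ∈ Finset.univ.erase l, gainOfTC (a q * b q * c q)) * e.2.1 * M ≤ D * M * e.2.1 * M := by
        have h1' : (∑ q ∈ Finset.univ.erase l, gainOfTC (a q * b q * c q)) * e.2.1 * M ≤
            e.1 * (((Vl * Vl / M + 3 * M) - 4 * Vl) * M) := by
          calc (∑ q ∈ Finset.univ.erase l, gainOfTC (a q * b q * c q)) * e.2.1 * M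
              ≤ e.1 * (∑ q ∈ Finset.univ.erase l, p q) * M := Nat.mul_le_mul_right _ hsumg
            _ ≤ e.1 * ((Vl * Vl / M + 3 * M) - 4 * Vl) * M := Nat.mul_le_mul_right _ (Nat.mul_le_mul_left _ hcap)
            _ = e.1 * (((Vl * Vl / M + 3 * M) - 4 * Vl) * M) := by ring
        have hce' := Nat.mul_le_mul_left e.1 hce
        rw [Nat.add_mul, Nat.add_mul]
        generalize (∑ q ∈ Finset.univ.erase l, gainOfTC (a q * b q * c q)) = S at h1' ⊢
        generalize ((Vl * Vl / M + 3 * M) - 4 * Vl) = cE at h1' hce'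
        generalize e.1 = gP at h1' hce' hP
        generalize e.2.1 = pP at h1' hP ⊢
        have e1 : gP * (cE * M + 4 * Vl * M) = gP * (cE * M) + 4 * Vl * M * gP := by ring
        rw [e1] at hce'
        have e2 : gP * (Vl * Vl + 3 * M * M) = Vl * Vl * gP + 3 * M * M * gP := by ring
        rw [e2] at hce'
        generalize g = gg at hP ⊢
        generalize D = DD at hP ⊢
        ring_nf at h1' hce' hP ⊢
        omega
      have hpos : 0 < e.2.1 * M := Nat.mul_pos hp1 hM1'
      have key' : (g + ∑ q ∈ Finset.univ.erase l, gainOfTC (a q * b q * c q)) * (e.2.1 * M) ≤ D * M * (e.2.1 * M) := by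
        rw [← Nat.mul_assoc, ← Nat.mul_assoc]; exact key
      exact Nat.le_of_mul_le_mul_right key' hpos

/-- **The certificate excludes beating.** Under the hypotheses of `sum_gain_le`: `¬ Beats (12/5) M`. [original] -/
theorem not_beats_of_cert (hmono : monoOK nl nb = true)
    (hdom : ∀ V, 1 ≤ V → V ≤ 2880 → ∀ x ∈ triplesS V, domX V (gainOfTC V) x = true)
    (hck : ∀ V, 1 ≤ V → V ≤ 2880 → ∀ x ∈ triplesS V, checkShape V (gainOfTC V) x = true)
    {N M : ℕ} {a b c : Fin N → ℕ} (hN : 2 ≤ N) (hlo : 628 ≤ M) (hM : M ≤ 2880)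
    (hS : SieveAdmissible M a b c) (hG : U11G M a b c) (hE : TAKnap575.E3Adm M a b c) : ¬ Beats (12 / 5) M a b c := by
  have hsum := sum_gain_le hmono hdom hck hN hlo hM hS hG hE
  have hV : ∀ i, a i * b i * c i ≤ 2880 := fun i => by
    have := (hS.1 i).2.2.2; simp only [shapeVol] at this; omega
  unfold Beats
  simp only [shapeVol, not_lt]
  have hle : ∑ i, ((a i * b i * c i : ℕ) : ℝ) ^ ((12 / 5 : ℝ) / 3) ≤
      ∑ i, (gainOfTC (a i * b i * c i) : ℝ) / 1000000 :=
    Finset.sum_le_sum fun i _ => ShapeCert.rpow_le_gainTC _ (hV i)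
  rw [← Finset.sum_div] at hle
  refine hle.trans ?_
  rw [div_le_iff₀ (by norm_num)]
  have h2 : ((∑ i, gainOfTC (a i * b i * c i) : ℕ) : ℝ) ≤ ((D * M : ℕ) : ℝ) := by exact_mod_cast hsum
  push_cast at h2
  simpa [D, mul_comm] using h2

end Summit.MatrixMultiplication.MatrixMultiplication.Theorems.TCStat
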